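import Mathlib.Combinatorics.SimpleGraph.Walk.Counting
import Mathlib.Combinatorics.SimpleGraph.Paths
import Mathlib.Combinatorics.SimpleGraph.Operations
import Mathlib.Topology.Algebra.InfiniteSum.ENNReal
import Summits.CriticalPhenomena.SAWScalingLimit.Theorems.SAWTotalPositivityBoundaryTP2Defs
import Summits.CriticalPhenomena.SAWScalingLimit.Theorems.SAWTotalPositivityBoundaryTP2Kernel
import Summits.CriticalPhenomena.SAWScalingLimit.Theorems.SAWTotalPositivityBoundaryTP2Symmetry
import Summits.CriticalPhenomena.SAWScalingLimit.Theorems.SAWTotalPositivityBoundaryTP2FirstStep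
import Summits.CriticalPhenomena.SAWScalingLimit.Theorems.SAWTotalPositivityBoundaryTP2Avoid
import Summits.CriticalPhenomena.SAWScalingLimit.Theorems.SAWTotalPositivityBoundaryTP2SquareGadget
import HarnessLib

/-!
# Crux `LeftRightFKG` (stmt-CriticalPhenomena-11232), line `corner-localisation` (v8):
stub `stub_squareLeOne` — the 4-cycle gadget

For `0 < x < 1`, the sibling core `BoundaryTP2.GraphTP2At x` (TP₂ of the fugacity-`x` self-avoiding
path kernel on every subgraph of `ℤ²` with finitely many non-isolated vertices), together with the
kernel identity for paths through a degree-2 vertex (the line's stub `stub_visitDeg2`, taken here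
as the hypothesis `hV`), forces the uniform two-point bound

  `Z_H(u, u') ≤ 1`

for every `H ≤ zdGraph 2` with `H.support` finite and every pair `u ≠ u'` having two common
lattice neighbours `p ≠ q` that are isolated in `H` (a diagonal pair of a unit square whose other
two corners are free).

Proof (the *4-cycle gadget*, analogue of the sibling's
`SquareGadget.pathKernel_le_one_of_graphTP2At`): hang the 4-cycle `u p u' q` on `H`, i.e.
`G = H ⊔ K` with `K` the four edges `p u`, `p u'`, `q u`, `q u'`. In `G` the hung vertices have
`N_G(p) = N_G(q) = {u, u'}`, so the quadruple `(u, p, u', q)` is interlaced (a path `p → q` starts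
with the edge to `u` or to `u'`) and both nested pairings are single edges; the core gives
`Z_G(u,u') Z_G(p,q) ≤ Z_G(u,p) Z_G(u',q)`. With `Z = Z_H(u,u')`, first-step decompositions at
`p`, `q` (`pathKernel_firstStep_pair`), the dictionary "paths avoiding a vertex = paths of the
vertex-deleted graph" (`stub_pathKernelOn_avoid`) and `hV` for the paths through a hung vertex
evaluate the four kernels exactly:
`Z_G(u,u') = Z + 2x²`, `Z_G(p,q) = 2x²(1 + Z)`, `Z_G(u,p) = Z_G(u',q) = x(1 + Z + x²)`.
TP₂ then reads `2(Z + 2x²)(1 + Z) ≤ (1 + Z + x²)²`, i.e. `Z² + 2x² Z + 2x² - x⁴ - 1 ≤ 0`,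
impossible for `Z ≥ 1` since `x⁴ < x²`; hence `Z ≤ 1`. Everything here is proved. [folklore]
-/

noncomputable section
open Literature.Probability.LatticeModels
open Summit.CriticalPhenomena.SAWScalingLimit.Theorems.BoundaryTP2
open scoped ENNReal

namespace Summit.CriticalPhenomena.SAWScalingLimit.Theorems.LeftRightFKG.CornerGadget

variable {V : Type*}

/-! ## The gadget graph `G = H ⊔ K_{{p,q},{u,u'}}`: neighbourhoods and vertex deletions -/

/-- In the gadget graph (adjacency `hG`), a hung vertex `c ∈ {p, q}` that is isolated in `H` and
distinct from `u, u'` is adjacent exactly to `u` and `u'`. [folklore] -/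
private theorem gadget_adj_iff {H G : SimpleGraph V} {p q u u' c : V}
    (hG : ∀ a b, G.Adj a b ↔ H.Adj a b ∨
      (a ≠ b ∧ (((a = p ∨ a = q) ∧ (b = u ∨ b = u')) ∨ ((b = p ∨ b = q) ∧ (a = u ∨ a = u')))))
    (hc : c = p ∨ c = q) (hcH : c ∉ H.support) (hcu : c ≠ u) (hcu' : c ≠ u') (z : V) :
    G.Adj c z ↔ z = u ∨ z = u' := by
  rw [hG]
  constructor
  · rintro (h | ⟨-, ⟨-, h⟩ | ⟨-, h⟩⟩)
    · exact (hcH ⟨z, h⟩).elim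
    · exact h
    · rcases h with rfl | rfl
      · exact (hcu rfl).elim
      · exact (hcu' rfl).elim
  · intro h
    refine Or.inr ⟨?_, Or.inl ⟨hc, h⟩⟩
    rintro rfl
    rcases h with rfl | rfl
    · exact hcu rfl
    · exact hcu' rfl

/-- Neighbour set of a hung vertex of the gadget graph: `N_G(c) = {u, u'}`. [folklore] -/
private theorem gadget_neighborSet {H G : SimpleGraph V} {p q u u' c : V}
    (hG : ∀ a b, G.Adj a b ↔ H.Adj a b ∨
      (a ≠ b ∧ (((a = p ∨ a = q) ∧ (b = u ∨ b = u')) ∨ ((b = p ∨ b = q) ∧ (a = u ∨ a = u')))))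
    (hc : c = p ∨ c = q) (hcH : c ∉ H.support) (hcu : c ≠ u) (hcu' : c ≠ u') :
    G.neighborSet c = {u, u'} := by
  ext z
  rw [SimpleGraph.mem_neighborSet, gadget_adj_iff hG hc hcH hcu hcu', Set.mem_insert_iff,
    Set.mem_singleton_iff]

/-- After deleting another vertex `d ∉ {c, u, u'}`, the hung vertex `c` keeps the neighbours
`u, u'`: `N_{G - d}(c) = {u, u'}`. [folklore] -/
private theorem gadget_delete_neighborSet {H G : SimpleGraph V} {p q u u' c d : V}
    (hG : ∀ a b, G.Adj a b ↔ H.Adj a b ∨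
      (a ≠ b ∧ (((a = p ∨ a = q) ∧ (b = u ∨ b = u')) ∨ ((b = p ∨ b = q) ∧ (a = u ∨ a = u')))))
    (hc : c = p ∨ c = q) (hcH : c ∉ H.support) (hcu : c ≠ u) (hcu' : c ≠ u')
    (hdc : d ≠ c) (hdu : d ≠ u) (hdu' : d ≠ u') :
    (G.deleteEdges (G.incidenceSet d)).neighborSet c = {u, u'} := by
  ext z
  rw [SimpleGraph.mem_neighborSet, deleteEdges_incidenceSet_adj, gadget_adj_iff hG hc hcH hcu hcu',
    Set.mem_insert_iff, Set.mem_singleton_iff]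
  constructor
  · exact fun h => h.1
  · rintro (rfl | rfl)
    · exact ⟨Or.inl rfl, hdc.symm, hdu.symm⟩
    · exact ⟨Or.inr rfl, hdc.symm, hdu'.symm⟩

/-- Deleting both hung vertices `{c, d} = {p, q}` (isolated in `H`) from the gadget graph recovers
`H`: `(G - d) - c = H`. [folklore] -/
private theorem gadget_delete_delete {H G : SimpleGraph V} {p q u u' c d : V}
    (hG : ∀ a b, G.Adj a b ↔ H.Adj a b ∨
      (a ≠ b ∧ (((a = p ∨ a = q) ∧ (b = u ∨ b = u')) ∨ ((b = p ∨ b = q) ∧ (a = u ∨ a = u')))))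
    (hp : p = c ∨ p = d) (hq : q = c ∨ q = d) (hcH : c ∉ H.support) (hdH : d ∉ H.support) :
    (G.deleteEdges (G.incidenceSet d)).deleteEdges
        ((G.deleteEdges (G.incidenceSet d)).incidenceSet c) = H := by
  ext a b
  rw [deleteEdges_incidenceSet_adj, deleteEdges_incidenceSet_adj, hG]
  constructor
  · rintro ⟨⟨h | ⟨-, h⟩, had, hbd⟩, hac, hbc⟩
    · exact h
    · exfalso
      rcases h with ⟨ha, -⟩ | ⟨hb, -⟩
      · rcases ha with rfl | rfl
        · rcases hp with rfl | rfl
          · exact hac rfl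
          · exact had rfl
        · rcases hq with rfl | rfl
          · exact hac rfl
          · exact had rfl
      · rcases hb with rfl | rfl
        · rcases hp with rfl | rfl
          · exact hbc rfl
          · exact hbd rfl
        · rcases hq with rfl | rfl
          · exact hbc rfl
          · exact hbd rfl
  · intro h
    have ha : a ∈ H.support := ⟨b, h⟩
    have hb : b ∈ H.support := ⟨a, h.symm⟩
    exact ⟨⟨Or.inl h, fun e => hdH (e ▸ ha), fun e => hdH (e ▸ hb)⟩, fun e => hcH (e ▸ ha),
      fun e => hcH (e ▸ hb)⟩

/-! ## The 4-cycle gadget -/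

/-- **The 4-cycle gadget** (registered stub `stub_squareLeOne` of the line `corner-localisation` of
crux `LeftRightFKG`). For `0 < x < 1`, the core `GraphTP2At x` and the degree-2 visiting identity
(hypothesis `hV`, the line's stub `stub_visitDeg2`) force `Z_H(u,u') ≤ 1` for every `H ≤ zdGraph 2`
with finitely many non-isolated vertices and every `u ≠ u'` with two common lattice neighbours
`p ≠ q` isolated in `H`: hang the 4-cycle `u p u' q`, apply the core to `(u, p, u', q)` and
evaluate the four kernels exactly; TP₂ reads `2(Z + 2x²)(1 + Z) ≤ (1 + Z + x²)²`, which fails for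
`Z ≥ 1`. See the module docstring. [folklore] -/
theorem stub_squareLeOne : ∀ x : ℝ, 0 < x → x < 1 → GraphTP2At x →
    (∀ (G : SimpleGraph (Site 2)) (x : ℝ) (c s r t : Site 2), 0 ≤ x →
      G.neighborSet c = {s, r} → s ≠ r → t ≠ c → t ≠ s →
      pathKernelOn G x s t {γ | c ∈ γ.1.support} =
        ENNReal.ofReal (x ^ 2) * pathKernel (G.deleteEdges (G.incidenceSet c ∪ G.incidenceSet s)) x r t) →
    ∀ (H : SimpleGraph (Site 2)), H ≤ zdGraph 2 → H.support.Finite →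
    ∀ u u' p q : Site 2, u ≠ u' → p ≠ q → p ∉ H.support → q ∉ H.support →
      (zdGraph 2).Adj p u → (zdGraph 2).Adj p u' → (zdGraph 2).Adj q u → (zdGraph 2).Adj q u' →
      pathKernel H x u u' ≤ 1 := by
  intro x hx0 hx1 h hV H hH hfin u u' p q huu' hpq hp hq hpu hpu' hqu hqu'
  classical
  -- distinctness
  have hpu_ne : p ≠ u := hpu.ne
  have hpu'_ne : p ≠ u' := hpu'.ne
  have hqu_ne : q ≠ u := hqu.ne
  have hqu'_ne : q ≠ u' := hqu'.ne
  -- the gadget graph `G = H ⊔ K`, `K` the four edges `p u`, `p u'`, `q u`, `q u'`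
  obtain ⟨G, hGdef⟩ : ∃ G : SimpleGraph (Site 2),
      G = H ⊔ SimpleGraph.fromRel (fun a b => (a = p ∨ a = q) ∧ (b = u ∨ b = u')) := ⟨_, rfl⟩
  have hG : ∀ a b, G.Adj a b ↔ H.Adj a b ∨
      (a ≠ b ∧ (((a = p ∨ a = q) ∧ (b = u ∨ b = u')) ∨ ((b = p ∨ b = q) ∧ (a = u ∨ a = u')))) := by
    intro a b
    rw [hGdef, SimpleGraph.sup_adj, SimpleGraph.fromRel_adj]
  have hGzd : G ≤ zdGraph 2 := by
    intro a b hab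
    rcases (hG a b).1 hab with hab | ⟨-, ⟨ha, hb⟩ | ⟨hb, ha⟩⟩
    · exact hH hab
    · rcases ha with rfl | rfl <;> rcases hb with rfl | rfl
      exacts [hpu, hpu', hqu, hqu']
    · rcases ha with rfl | rfl <;> rcases hb with rfl | rfl
      exacts [hpu.symm, hqu.symm, hpu'.symm, hqu'.symm]
  have hGfin : G.support.Finite := by
    refine (hfin.union ((((Set.finite_singleton u').insert u).insert q).insert p)).subset ?_
    rintro a ⟨b, hab⟩
    rcases (hG a b).1 hab with hab | ⟨-, ⟨ha, -⟩ | ⟨-, ha⟩⟩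
    · exact Or.inl ⟨b, hab⟩
    · right; rcases ha with rfl | rfl <;> simp
    · right; rcases ha with rfl | rfl <;> simp
  -- neighbourhoods of the hung vertices, in `G` and after deleting the other hung vertex
  have hNp : ∀ z, G.Adj p z ↔ z = u ∨ z = u' := gadget_adj_iff hG (Or.inl rfl) hp hpu_ne hpu'_ne
  have hNq : ∀ z, G.Adj q z ↔ z = u ∨ z = u' := gadget_adj_iff hG (Or.inr rfl) hq hqu_ne hqu'_ne
  have hN_p : G.neighborSet p = {u, u'} := gadget_neighborSet hG (Or.inl rfl) hp hpu_ne hpu'_ne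
  have hN_q : G.neighborSet q = {u, u'} := gadget_neighborSet hG (Or.inr rfl) hq hqu_ne hqu'_ne
  set Gp := G.deleteEdges (G.incidenceSet p)
  set Gq := G.deleteEdges (G.incidenceSet q)
  have hN_Gp_q : Gp.neighborSet q = {u, u'} :=
    gadget_delete_neighborSet hG (Or.inr rfl) hq hqu_ne hqu'_ne hpq hpu_ne hpu'_ne
  have hN_Gq_p : Gq.neighborSet p = {u, u'} :=
    gadget_delete_neighborSet hG (Or.inl rfl) hp hpu_ne hpu'_ne (Ne.symm hpq) hqu_ne hqu'_ne
  -- `(G - p) - q = H = (G - q) - p`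
  have hGpq : Gp.deleteEdges (Gp.incidenceSet q) = H :=
    gadget_delete_delete (c := q) (d := p) hG (Or.inr rfl) (Or.inl rfl) hq hp
  have hGqp : Gq.deleteEdges (Gq.incidenceSet p) = H :=
    gadget_delete_delete (c := p) (d := q) hG (Or.inl rfl) (Or.inr rfl) hp hq
  -- the gadget kernels in terms of `Z = Z_H(u,u')`
  have hxle : 0 ≤ x := hx0.le
  set Z := pathKernel H x u u'
  -- paths `u' → u` of `G - p`: through `q` they weigh `x²` (by `hV`); avoiding `q`, paths of `H`
  have hA : pathKernel Gp x u' u = ENNReal.ofReal (x ^ 2) + Z := by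
    rw [← pathKernelOn_add_compl (H := Gp) x u' u {γ | q ∈ γ.1.support}, Set.compl_setOf,
      hV Gp x q u' u u hxle (by rw [hN_Gp_q, Set.pair_comm]) huu'.symm hqu_ne.symm huu',
      pathKernel_self, mul_one, stub_pathKernelOn_avoid Gp x u' u q hqu'_ne.symm hqu_ne.symm, hGpq,
      pathKernel_comm H x u' u]
  -- symmetrically, paths `u → u'` of `G - q`
  have hB : pathKernel Gq x u u' = ENNReal.ofReal (x ^ 2) + Z := by
    rw [← pathKernelOn_add_compl (H := Gq) x u u' {γ | p ∈ γ.1.support}, Set.compl_setOf,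
      hV Gq x p u u' u' hxle hN_Gq_p huu' hpu'_ne.symm huu'.symm, pathKernel_self, mul_one,
      stub_pathKernelOn_avoid Gq x u u' p hpu_ne.symm hpu'_ne.symm, hGqp]
  -- `Z_G(u,u') = x² + (x² + Z)`: split along the paths through `p`
  have K1 : pathKernel G x u u' = ENNReal.ofReal (x ^ 2) + (ENNReal.ofReal (x ^ 2) + Z) := by
    rw [← pathKernelOn_add_compl (H := G) x u u' {γ | p ∈ γ.1.support}, Set.compl_setOf,
      hV G x p u u' u' hxle hN_p huu' hpu'_ne.symm huu'.symm, pathKernel_self, mul_one,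
      stub_pathKernelOn_avoid G x u u' p hpu_ne.symm hpu'_ne.symm, pathKernel_comm Gp x u u', hA]
  -- `Z_G(p,q) = x (x (1 + Z) + x (Z + 1))`: first step at `p`, then at `q` in `G - p`
  have K2 : pathKernel G x p q = ENNReal.ofReal x *
      (ENNReal.ofReal x * (1 + Z) + ENNReal.ofReal x * (Z + 1)) := by
    rw [pathKernel_firstStep_pair G x hxle hpq huu' hN_p, pathKernel_comm Gp x u q,
      pathKernel_firstStep_pair Gp x hxle hqu_ne huu' hN_Gp_q, hGpq, pathKernel_self,
      pathKernel_comm H x u' u, pathKernel_comm Gp x u' q,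
      pathKernel_firstStep_pair Gp x hxle hqu'_ne huu' hN_Gp_q, hGpq, pathKernel_self]
  -- `Z_G(u,p) = x (1 + (x² + Z))`: first step at `p`
  have K3 : pathKernel G x u p = ENNReal.ofReal x * (1 + (ENNReal.ofReal (x ^ 2) + Z)) := by
    rw [pathKernel_comm G x u p, pathKernel_firstStep_pair G x hxle hpu_ne huu' hN_p,
      pathKernel_self, hA]
  -- `Z_G(u',q) = x ((x² + Z) + 1)`: first step at `q`
  have K4 : pathKernel G x u' q = ENNReal.ofReal x * (ENNReal.ofReal (x ^ 2) + Z + 1) := by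
    rw [pathKernel_comm G x u' q, pathKernel_firstStep_pair G x hxle hqu'_ne huu' hN_q,
      pathKernel_self, hB]
  -- hypotheses of the core for the quadruple `(u, p, u', q)` of `G`
  have hI : Interlaced G u p u' q := by
    intro P Q
    obtain ⟨v, hadj, q', hq'⟩ := SimpleGraph.Walk.exists_eq_cons_of_ne hpq Q.1
    have hvQ : v ∈ Q.1.support := by
      rw [hq', SimpleGraph.Walk.support_cons]
      exact List.mem_cons_of_mem _ q'.start_mem_support
    rcases (hNp v).1 hadj with rfl | rfl
    · exact ⟨_, P.1.start_mem_support, hvQ⟩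
    · exact ⟨_, P.1.end_mem_support, hvQ⟩
  have hGpu : G.Adj p u := (hNp u).2 (Or.inl rfl)
  have hGpu' : G.Adj p u' := (hNp u').2 (Or.inr rfl)
  have hGqu : G.Adj q u := (hNq u).2 (Or.inl rfl)
  have hGqu' : G.Adj q u' := (hNq u').2 (Or.inr rfl)
  have hD1 : DisjointPaths G u p u' q := by
    refine ⟨SimpleGraph.Path.singleton hGpu.symm, SimpleGraph.Path.singleton hGqu'.symm, ?_⟩
    simp only [SimpleGraph.Path.singleton_coe, SimpleGraph.Walk.support_cons,
      SimpleGraph.Walk.support_nil]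
    intro a ha hb
    simp only [List.mem_cons, List.not_mem_nil, or_false] at ha hb
    rcases ha with rfl | rfl <;> rcases hb with h' | h'
    exacts [huu' h', hqu_ne h'.symm, hpu'_ne h', hpq h']
  have hD2 : DisjointPaths G u q p u' := by
    refine ⟨SimpleGraph.Path.singleton hGqu.symm, SimpleGraph.Path.singleton hGpu', ?_⟩
    simp only [SimpleGraph.Path.singleton_coe, SimpleGraph.Walk.support_cons,
      SimpleGraph.Walk.support_nil]
    intro a ha hb
    simp only [List.mem_cons, List.not_mem_nil, or_false] at ha hb
    rcases ha with rfl | rfl <;> rcases hb with h' | h'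
    exacts [hpu_ne h'.symm, huu' h', hpq.symm h', hqu'_ne h']
  -- apply the core and evaluate
  have key := h G hGzd hGfin u p u' q hI hD1 hD2
  rw [K1, K2, K3, K4] at key
  have hZ_top : Z ≠ ⊤ := pathKernel_ne_top hfin x u u'
  have hZζ : Z = ENNReal.ofReal Z.toReal := (ENNReal.ofReal_toReal hZ_top).symm
  set ζ := Z.toReal
  have hζ0 : 0 ≤ ζ := ENNReal.toReal_nonneg
  rw [hZζ] at key ⊢
  have hx2 : 0 ≤ x ^ 2 := sq_nonneg x
  have e1 : ENNReal.ofReal (x ^ 2) + (ENNReal.ofReal (x ^ 2) + ENNReal.ofReal ζ) =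
      ENNReal.ofReal (x ^ 2 + (x ^ 2 + ζ)) := by
    rw [ENNReal.ofReal_add hx2 (add_nonneg hx2 hζ0), ENNReal.ofReal_add hx2 hζ0]
  have e2 : ENNReal.ofReal x * (ENNReal.ofReal x * (1 + ENNReal.ofReal ζ) +
      ENNReal.ofReal x * (ENNReal.ofReal ζ + 1)) =
      ENNReal.ofReal (x * (x * (1 + ζ) + x * (ζ + 1))) := by
    rw [ENNReal.ofReal_mul hxle, ENNReal.ofReal_add (mul_nonneg hxle (add_nonneg zero_le_one hζ0))
      (mul_nonneg hxle (add_nonneg hζ0 zero_le_one)), ENNReal.ofReal_mul hxle,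
      ENNReal.ofReal_mul hxle, ENNReal.ofReal_add zero_le_one hζ0,
      ENNReal.ofReal_add hζ0 zero_le_one, ENNReal.ofReal_one]
  have e3 : ENNReal.ofReal x * (1 + (ENNReal.ofReal (x ^ 2) + ENNReal.ofReal ζ)) =
      ENNReal.ofReal (x * (1 + (x ^ 2 + ζ))) := by
    rw [ENNReal.ofReal_mul hxle, ENNReal.ofReal_add zero_le_one (add_nonneg hx2 hζ0),
      ENNReal.ofReal_add hx2 hζ0, ENNReal.ofReal_one]
  have e4 : ENNReal.ofReal x * (ENNReal.ofReal (x ^ 2) + ENNReal.ofReal ζ + 1) =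
      ENNReal.ofReal (x * (x ^ 2 + ζ + 1)) := by
    rw [ENNReal.ofReal_mul hxle, ENNReal.ofReal_add (add_nonneg hx2 hζ0) zero_le_one,
      ENNReal.ofReal_add hx2 hζ0, ENNReal.ofReal_one]
  have hA0 : 0 ≤ x ^ 2 + (x ^ 2 + ζ) := by positivity
  have hC0 : 0 ≤ x * (1 + (x ^ 2 + ζ)) := by positivity
  have hCD0 : 0 ≤ x * (1 + (x ^ 2 + ζ)) * (x * (x ^ 2 + ζ + 1)) := by positivity
  rw [e1, e2, e3, e4, ← ENNReal.ofReal_mul hA0, ← ENNReal.ofReal_mul hC0,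
    ENNReal.ofReal_le_ofReal_iff hCD0] at key
  -- over `ℝ`: `key : (2x² + ζ) · x (x (1 + ζ) + x (ζ + 1)) ≤ x (1 + x² + ζ) · x (x² + ζ + 1)`
  have eqL : (x ^ 2 + (x ^ 2 + ζ)) * (x * (x * (1 + ζ) + x * (ζ + 1))) =
      x ^ 2 * (2 * ((2 * x ^ 2 + ζ) * (1 + ζ))) := by ring
  have eqR : x * (1 + (x ^ 2 + ζ)) * (x * (x ^ 2 + ζ + 1)) = x ^ 2 * (1 + x ^ 2 + ζ) ^ 2 := by ring
  rw [eqL, eqR] at key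
  have hs0 : 0 < x ^ 2 := by positivity
  have hs1 : x ^ 2 < 1 := by nlinarith
  have h3 : 2 * ((2 * x ^ 2 + ζ) * (1 + ζ)) ≤ (1 + x ^ 2 + ζ) ^ 2 := le_of_mul_le_mul_left key hs0
  have h5 : ζ ≤ 1 := by
    nlinarith [h3, hζ0, hs0, hs1, mul_pos hs0 (sub_pos.2 hs1), mul_nonneg hs0.le hζ0,
      sq_nonneg (ζ - 1)]
  calc ENNReal.ofReal ζ ≤ ENNReal.ofReal 1 := ENNReal.ofReal_le_ofReal h5
    _ = 1 := ENNReal.ofReal_one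

end Summit.CriticalPhenomena.SAWScalingLimit.Theorems.LeftRightFKG.CornerGadget
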